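import Summits.ABC.ABC.Theses.DefiniteXi
import Literature.NumberTheory.Automorphic.EichlerSubidealCount
import Literature.NumberTheory.Automorphic.DefiniteOrderUnitsFinite
import Literature.NumberTheory.Automorphic.BrandtXiSetupIndependence

/-!
# `XiBound` (stmt-ABC-11336, route ABC/DefiniteXi) — negative-side lemmas IV: the value gap `ξ ≠ 1`

Standing-adversary (cdisprove) output for the crux `Summit.ABC.ABC.Theses.DefiniteXi.XiBound`; a
boundary ("tightness") lemma on the object the crux bounds.  For EVERY elliptic curve `E/ℚ`, every type
`(N⁺, N⁻)` and every Brandt setup `S`, the definite congruence number `ξ_S(a(E))` is either the junk `0`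
(eigen-lattice not a line) or at least `2`: the generator `φ` of the `a(E)`-eigen-line has degree zero
(`Brandt.XiSetup.sum_eq_zero_of_eigenLattice_lFunction_eq_span`: Eichler's column sums `p + 1` and
`a_p(E) ≠ p + 1`), so it has two non-zero coordinates, and the weights are `≥ 1`
(`Brandt.XiSetup.one_le_weight`).  Hence `brandtXi N⁺ N⁻ (a(E)) ≠ 1` unconditionally — the honest
values of the crux's `ξ` start at `2` (e.g. `ξ = 4` for `E = 17a`, `N⁻ = 17`: `h = 2`, `w = (1, 3)`,
`φ = (1, −1)`).

* `xi_lFunction_eq_zero_or_two_le`, `brandtXi_lFunction_ne_one`.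

Refuter seat cdisprove-stmt-ABC-11336-g2, 2026-08-15.
-/

namespace Summit.ABC.ABC.Theorems.XiBound.Negative

open scoped BigOperators
open Literature.NumberTheory.Automorphic

/-- **Value gap**: in every Brandt setup, `ξ_S(a(E)) = 0` or `2 ≤ ξ_S(a(E))` for every elliptic `E/ℚ` —
the generator of the `a(E)`-eigen-line has degree zero (it is cuspidal: orthogonal to the Eisenstein
vector), hence at least two non-zero coordinates, each contributing `w_c φ_c² ≥ 1`. [cite: Gross1987, §2 (Eisenstein vector and degree)] -/
theorem xi_lFunction_eq_zero_or_two_le {Nplus Nminus : ℕ} (S : Brandt.XiSetup Nplus Nminus)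
    (W : WeierstrassCurve ℚ) [W.IsElliptic] :
    S.xi (fun n => W.LFunction n) = 0 ∨ 2 ≤ S.xi (fun n => W.LFunction n) := by
  classical
  letI : Fintype (Brandt.ClassSet S.O) := Fintype.ofFinite _
  rw [Brandt.XiSetup.xi, Brandt.xiOfOrder_eq]
  by_cases h : ∃ φ : Brandt.ClassSet S.O → ℤ, φ ≠ 0 ∧
      Brandt.eigenLattice (Nplus * Nminus) (Brandt.matrix S.O) (fun n => W.LFunction n) = ℤ ∙ φ
  · obtain ⟨φ, hφ, hL⟩ := h
    right
    rw [Brandt.xi_eq_sum _ hφ hL]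
    have hsum : ∑ i, φ i = 0 := S.sum_eq_zero_of_eigenLattice_lFunction_eq_span W hL
    obtain ⟨i, hi⟩ : ∃ i, φ i ≠ 0 := Function.ne_iff.mp hφ
    have hj : ∃ j, j ≠ i ∧ φ j ≠ 0 := by
      by_contra hno
      push Not at hno
      have hsingle : ∑ k, φ k = φ i :=
        Finset.sum_eq_single i (fun k _ hk => hno k hk) (fun hi' => absurd (Finset.mem_univ i) hi')
      exact hi (hsingle ▸ hsum)
    obtain ⟨j, hji, hj⟩ := hj
    have hterm : ∀ k, φ k ≠ 0 → 1 ≤ Brandt.weight S.O k * (φ k).natAbs ^ 2 := fun k hk =>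
      Nat.mul_le_mul (S.one_le_weight k) (Nat.one_le_pow _ _ (Int.natAbs_pos.mpr hk))
    calc 2 = 1 + 1 := rfl
      _ ≤ Brandt.weight S.O j * (φ j).natAbs ^ 2 + Brandt.weight S.O i * (φ i).natAbs ^ 2 :=
          add_le_add (hterm j hj) (hterm i hi)
      _ ≤ ∑ k, Brandt.weight S.O k * (φ k).natAbs ^ 2 :=
          Finset.add_le_sum (f := fun k => Brandt.weight S.O k * (φ k).natAbs ^ 2)
            (fun k _ => Nat.zero_le _) (Finset.mem_univ j) (Finset.mem_univ i) hji
  · left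
    exact Brandt.xi_of_not_isLine _ h

/-- **`brandtXi N⁺ N⁻ (a(E)) ≠ 1`** for every elliptic `E/ℚ` and every type `(N⁺, N⁻)`: without a
setup the value is `0`; with one it is `ξ_S ∈ {0} ∪ [2, ∞)` (`xi_lFunction_eq_zero_or_two_le`,
`Brandt.XiSetup.brandtXi_eq_xi`). The honest values of the `ξ` bounded by the crux start at `2`. [folklore] -/
theorem brandtXi_lFunction_ne_one (Nplus Nminus : ℕ) (W : WeierstrassCurve ℚ) [W.IsElliptic] :
    brandtXi Nplus Nminus (fun n => W.LFunction n) ≠ 1 := by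
  by_cases hne : Nonempty (Brandt.XiSetup Nplus Nminus)
  · obtain ⟨S⟩ := hne
    rw [S.brandtXi_eq_xi]
    rcases xi_lFunction_eq_zero_or_two_le S W with h | h
    · rw [h]; exact zero_ne_one
    · omega
  · rw [brandtXi_of_isEmpty (not_nonempty_iff.mp hne)]
    exact zero_ne_one

end Summit.ABC.ABC.Theorems.XiBound.Negative
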